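import Summits.HubbardSuperconductivity.HubbardSuperconductivity.Theorems.LevyLogBootstrapHalfFilledOrderWindow
import HarnessLib

/-!
# Route `LevyLogBootstrap`, hub `HalfFilledOrder` (stmt-HubbardSuperconductivity-0906) — normal form:
# the hub IS the tracial planar long-range order of the spin-½ anisotropic torus, pointwise in `Δ`

`HalfFilledOrder` (shared verbatim by `LevyLogBootstrap`, `AnisotropyChord` and, as
`PbHalfFilledXYOrder`, `PlaquetteBoson`; also the consequent of the crux `LevyTransport`) is stated
in the SECTOR form the routes consume: for every `Δ ∈ (-1, 0]`, planar order
`c(Δ)·M⁴ ≤ Re⟨ψ, S⁺_tot S⁻_tot ψ⟩` of every normalised `S³_tot = 0` sector ground state `ψ` of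
`H_M(Δ) = xxzHamiltonian 1 (torusGraph 2 M) (-1) Δ` on large even tori. The Literature states
ground-state order in the TRACIAL form `HasEvenTorusLRO (fun L x y => groundStateAxisCorrTorus L 1 1 Δ 1 x y)`
(Björnberg–Ueltschi's `anisotropicTorus 2 L 1 1 Δ 1`, third-axis two-point function of the tracial
ground-state functional; this is the vocabulary of `bjornbergUeltschi2022_ground_lro_spinHalf`,
`wischmannMullerHartmann1991_ground_lro_spinHalf`, `kennedy_lieb_shastry_xy_ground`). This file
proves that for every `Δ ≤ 0` the two forms are EQUIVALENT, pointwise in `Δ`: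

* `halfFilledOrderAt_of_hasEvenTorusLRO` (tracial LRO ⇒ sector order at `Δ ≤ 0`; the argument of
  `halfFilledOrder_window`, with the Björnberg–Ueltschi fact replaced by an arbitrary LRO hypothesis);
* `hasEvenTorusLRO_of_halfFilledOrderAt` (sector order ⇒ tracial LRO at `Δ ≤ 0`; new ingredient:
  `⟨ψ, (Sˣ_tot)² ψ⟩ = ⟨ψ, (Sʸ_tot)² ψ⟩` for every vector of a fixed `S³_tot` sector, by orthogonality of
  sectors — `(Sˣ)² - (Sʸ)² = ((S⁺)² + (S⁻)²)/2` moves the sector by `±2`);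
* `halfFilledOrder_iff_hasEvenTorusLRO` and `halfFilledOrder_iff_hasEvenTorusLRO_deep`: the hub is
  EXACTLY "tracial planar LRO of `anisotropicTorus 2 L 1 1 Δ 1` for every `Δ ∈ (-1, 0]`", and — the
  window `[-0.109, 0]` being proved (`halfFilledOrder_window`) — for every `Δ ∈ (-1, -0.109)`;
* `halfFilledOrder_wmhWindow`, `halfFilledOrder_iff_hasEvenTorusLRO_deep_of_wmh`: CONDITIONAL on the
  (vendored, not discharged) Wischmann–Müller-Hartmann window
  `wischmannMullerHartmann1991_ground_lro_spinHalf` (`0 ≤ -Δ ≤ 0.22`), sector order holds on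
  `[-0.22, 0]` and the hub reduces to tracial LRO on `(-1, -0.22)`.

So any future Literature LRO theorem for the spin-½ easy-plane XXZ torus feeds the three routes by a
one-line instantiation, and conversely a proof of the hub is a Literature-grade LRO theorem.

Sources: J. E. Björnberg, D. Ueltschi, in *The Physics and Mathematics of Elliott Lieb* I (EMS, 2022)
77–108 = arXiv:2204.12896, Thm. 3.2 and p. 11; H.-A. Wischmann, E. Müller-Hartmann, J. Phys. I
France 1 (1991) 647; T. Kennedy, E. H. Lieb, B. S. Shastry, J. Stat. Phys. 53 (1988) 1019;
M. Aizenman, E. H. Lieb, R. Seiringer, J. P. Solovej, J. Yngvason, PRA 70 (2004) 023612, App. A;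
H. Tasaki, *Physics and Mathematics of Quantum Many-Body Systems* (2020) §2.4. No definition is
introduced.
-/

-- the mandated namespace `Summit.<Summit>.<Problem>.Theorems` repeats `HubbardSuperconductivity`
set_option linter.dupNamespace false

noncomputable section

namespace Summit.HubbardSuperconductivity.HubbardSuperconductivity.Theorems.LevyLogBootstrap

open Matrix Finset Filter Complex
open Literature.MathematicalPhysics.QuantumLattice Literature.Probability.LatticeModels
open Summit.HubbardSuperconductivity.HubbardSuperconductivity.Theses.LevyLogBootstrap
open Summit.HubbardSuperconductivity.HubbardSuperconductivity.Theorems.AnisotropyChord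
  (raiseOn_mul_lowerOn_mulVec_of_mem_zero)

/-! ### Orthogonality of magnetisation sectors; `⟨(Sˣ_tot)²⟩ = ⟨(Sʸ_tot)²⟩` on a sector -/

section Sectors

variable {Λ : Type*} [Fintype Λ] [DecidableEq Λ]

/-- **Distinct `S³_tot`-sectors are orthogonal**: if `S³_tot v = m v`, `S³_tot w = m' w` with
`m ≠ m'` then `⟨v, w⟩ = 0` (`S³_tot` is Hermitian with real eigenvalues). Tasaki (2020) §2.4.
[folklore] -/
theorem star_dotProduct_eq_zero_of_mem_spinZSector (n : ℕ) {m m' : ℝ} (hne : m ≠ m')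
    {v w : TensorIndex Λ (n + 1) → ℂ} (hv : v ∈ spinZSector (Λ := Λ) n m)
    (hw : w ∈ spinZSector (Λ := Λ) n m') : star v ⬝ᵥ w = 0 := by
  have hv' := (mem_spinZSector_iff_mulVec n m v).1 hv
  have hw' := (mem_spinZSector_iff_mulVec n m' w).1 hw
  have h1 : star v ⬝ᵥ zOn n Finset.univ *ᵥ w = (m' : ℂ) * (star v ⬝ᵥ w) := by
    rw [hw', dotProduct_smul, smul_eq_mul]
  have h2 : star v ⬝ᵥ zOn n Finset.univ *ᵥ w = (m : ℂ) * (star v ⬝ᵥ w) := by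
    calc star v ⬝ᵥ zOn n Finset.univ *ᵥ w = (star v ᵥ* zOn n Finset.univ) ⬝ᵥ w :=
          dotProduct_mulVec _ _ _
      _ = star (zOn n Finset.univ *ᵥ v) ⬝ᵥ w := by rw [star_mulVec, zOn_conjTranspose]
      _ = (m : ℂ) * (star v ⬝ᵥ w) := by
          rw [hv', star_smul, smul_dotProduct, smul_eq_mul, Complex.star_def, Complex.conj_ofReal]
  have h3 : ((m' : ℂ) - m) * (star v ⬝ᵥ w) = 0 := by rw [sub_mul, ← h1, ← h2, sub_self]
  rcases mul_eq_zero.1 h3 with h | h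
  · exact absurd (by exact_mod_cast (sub_eq_zero.1 h).symm) hne
  · exact h

/-- `(S⁺_tot)² + (S⁻_tot)² = 2(Sˣ_tot)² - 2(Sʸ_tot)²` (from `S^± = Sˣ ± iSʸ`). Tasaki (2020) §2.4,
eq. (2.4.6). [folklore] -/
theorem raiseOn_sq_add_lowerOn_sq (n : ℕ) :
    raiseOn n (Finset.univ : Finset Λ) * raiseOn n Finset.univ +
        lowerOn n (Finset.univ : Finset Λ) * lowerOn n Finset.univ =
      (2 : ℂ) • (totalSpin n 0 * totalSpin n 0) - (2 : ℂ) • (totalSpin n 1 * totalSpin n 1) := by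
  rw [raiseOn_univ, lowerOn_univ]
  simp only [mul_add, add_mul, mul_sub, sub_mul, smul_mul_assoc, mul_smul_comm, smul_add,
    smul_sub, smul_smul, Complex.I_mul_I, neg_smul, one_smul]
  module

/-- **`⟨ψ, (Sˣ_tot)² ψ⟩ = ⟨ψ, (Sʸ_tot)² ψ⟩` on every `S³_tot` sector**: `(Sˣ)² - (Sʸ)²` is half of
`(S⁺)² + (S⁻)²`, which moves the sector by `±2`, hence has zero expectation in a sector vector
(orthogonality of sectors). This is the `U(1)` symmetry of the planar second moments, without any
Hamiltonian. Tasaki (2020) §2.4. [folklore] -/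
theorem dotProduct_totalSpinX_sq_eq_totalSpinY_sq (n : ℕ) {m : ℝ}
    {ψ : TensorIndex Λ (n + 1) → ℂ} (hψ : ψ ∈ spinZSector (Λ := Λ) n m) :
    star ψ ⬝ᵥ (totalSpin n 0 * totalSpin n 0) *ᵥ ψ =
      star ψ ⬝ᵥ (totalSpin n 1 * totalSpin n 1) *ᵥ ψ := by
  have hP : star ψ ⬝ᵥ (raiseOn n Finset.univ * raiseOn n Finset.univ) *ᵥ ψ = 0 := by
    rw [← mulVec_mulVec]
    exact star_dotProduct_eq_zero_of_mem_spinZSector n (by linarith : m ≠ m + 1 + 1) hψ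
      (raiseOn_mulVec_mem n (raiseOn_mulVec_mem n hψ))
  have hQ : star ψ ⬝ᵥ (lowerOn n Finset.univ * lowerOn n Finset.univ) *ᵥ ψ = 0 := by
    rw [← mulVec_mulVec]
    exact star_dotProduct_eq_zero_of_mem_spinZSector n (by linarith : m ≠ m - 1 - 1) hψ
      (lowerOn_mulVec_mem n (lowerOn_mulVec_mem n hψ))
  have h := congrArg (fun A : Op Λ (n + 1) => star ψ ⬝ᵥ A *ᵥ ψ) (raiseOn_sq_add_lowerOn_sq (Λ := Λ) n)
  simp only [add_mulVec, sub_mulVec, smul_mulVec, dotProduct_add, dotProduct_sub,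
    dotProduct_smul, hP, hQ, smul_eq_mul] at h
  linear_combination (-(1 : ℂ) / 2) * h

end Sectors

/-! ### Tracial planar LRO ⇒ half-filled sector order, at every `Δ ≤ 0` -/

/-- **Floor form of tracial planar LRO** at a fixed `Δ`: a positive `liminf` of the nonnegative
sequence `(2k)⁻⁴ Σ_{x,y} G³_{2k}(x,y)` is eventually undercut by a smaller positive number, giving
`a·M⁴ ≤ Σ_{x,y} G³_M(x,y)` for all large even `M` (the argument of `bu_axisFloor`, with the
Björnberg–Ueltschi fact replaced by an LRO hypothesis). [folklore] -/
theorem axisFloor_of_hasEvenTorusLRO {Δ : ℝ}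
    (hLRO : HasEvenTorusLRO (fun L x y => groundStateAxisCorrTorus (d := 2) L 1 1 Δ 1 x y)) :
    ∃ a : ℝ, 0 < a ∧ ∃ M₀ : ℕ, ∀ (M : ℕ) [NeZero M], Even M → M₀ ≤ M →
      a * (M : ℝ) ^ 4 ≤
        ∑ x : TorusSite 2 M, ∑ y : TorusSite 2 M, groundStateAxisCorrTorus (d := 2) M 1 1 Δ 1 x y := by
  unfold HasEvenTorusLRO HasLongRangeOrder at hLRO
  rw [← Filter.liminf_nat_add _ 1] at hLRO
  have key : ∀ k : ℕ,
      (∑ x ∈ halfOpenBox 2 (2 * (k + 1)), ∑ y ∈ halfOpenBox 2 (2 * (k + 1)),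
          torusPullback (fun L x y => groundStateAxisCorrTorus (d := 2) L 1 1 Δ 1 x y)
            (2 * (k + 1)) x y) /
        ((halfOpenBox 2 (2 * (k + 1))).card : ℝ) ^ 2 =
      (∑ x : TorusSite 2 (2 * k + 1 + 1), ∑ y : TorusSite 2 (2 * k + 1 + 1),
          groundStateAxisCorrTorus (d := 2) (2 * k + 1 + 1) 1 1 Δ 1 x y) /
        (((2 * k + 1 + 1 : ℕ) : ℝ) ^ 2) ^ 2 := by
    intro k
    rw [show 2 * (k + 1) = 2 * k + 1 + 1 by ring, XYOrderProofs.sum_halfOpenBox_torusPullback,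
      card_halfOpenBox, Nat.cast_pow]
  simp only [key] at hLRO
  have hnn : ∀ k : ℕ, 0 ≤ (∑ x : TorusSite 2 (2 * k + 1 + 1), ∑ y : TorusSite 2 (2 * k + 1 + 1),
      groundStateAxisCorrTorus (d := 2) (2 * k + 1 + 1) 1 1 Δ 1 x y) /
        (((2 * k + 1 + 1 : ℕ) : ℝ) ^ 2) ^ 2 :=
    fun k => div_nonneg (sum_sum_groundStateAxisCorrTorus_nonneg _ 1 1 Δ 1) (by positivity)
  obtain ⟨a, ha0, hal⟩ := exists_between hLRO
  have hev := Filter.eventually_lt_of_lt_liminf hal (isBoundedUnder_of ⟨0, hnn⟩)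
  obtain ⟨K₀, hK₀⟩ := Filter.eventually_atTop.1 hev
  refine ⟨a, ha0, 2 * K₀ + 2, fun M _ hMeven hM => ?_⟩
  obtain ⟨j, hj⟩ := hMeven
  obtain ⟨k, rfl⟩ : ∃ k, M = 2 * k + 1 + 1 := ⟨j - 1, by omega⟩
  have hk : K₀ ≤ k := by omega
  have h := hK₀ k hk
  rw [lt_div_iff₀ (by positivity)] at h
  have h4 : (((2 * k + 1 + 1 : ℕ) : ℝ) ^ 2) ^ 2 = ((2 * k + 1 + 1 : ℕ) : ℝ) ^ 4 := by ring
  rw [h4] at h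
  exact h.le

/-- **Tracial planar LRO ⇒ half-filled sector order** at every `Δ ≤ 0`: if the third-axis
ground-state two-point function of `anisotropicTorus 2 M 1 1 Δ 1` has long-range order along even
tori, then every normalised `S³_tot = 0` sector ground state `ψ` of `H_M(Δ)` on a large even torus
has `c·M⁴ ≤ Re⟨ψ, S⁺_tot S⁻_tot ψ⟩`. Frame dictionary `H_M(Δ) = H₃(1,1,Δ)`
(`re_groundStateFunctional_xx_eq_axisCorr`), uniqueness of the half-filled ground state for
`Δ ≤ 0` (`xxzTorus_groundSpace_eq_span`: every ground vector is half filled, Perron–Frobenius in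
the sector) so that the tracial functional is `⟨ψ, · ψ⟩`, and `(Sˣ)² + (Sʸ)² = S⁺S⁻` on the sector.
[cite: BjornbergUeltschi2022, Theorem 3.2 and p. 11] -/
theorem halfFilledOrderAt_of_hasEvenTorusLRO {Δ : ℝ} (hΔ : Δ ≤ 0)
    (hLRO : HasEvenTorusLRO (fun L x y => groundStateAxisCorrTorus (d := 2) L 1 1 Δ 1 x y)) :
    ∃ c : ℝ, 0 < c ∧ ∃ M₀ : ℕ, ∀ (M : ℕ) [NeZero M], Even M →
      M₀ ≤ M → ∀ (ψ : TensorIndex (TorusSite 2 M) 2 → ℂ),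
      ψ ∈ spinZSector (Λ := TorusSite 2 M) 1 0 → star ψ ⬝ᵥ ψ = 1 →
      Matrix.mulVec (xxzHamiltonian 1 (torusGraph 2 M) (-1) Δ) ψ =
        ((lowestEnergyInSector 1 (xxzHamiltonian 1 (torusGraph 2 M) (-1) Δ) 0 : ℝ) : ℂ) • ψ →
      c * (M : ℝ) ^ 4 ≤ (star ψ ⬝ᵥ Matrix.mulVec
        ((∑ x : TorusSite 2 M, onSite x (spinRaise 1)) *
          (∑ y : TorusSite 2 M, onSite y (spinLower 1))) ψ).re := by
  obtain ⟨a, ha, M₀, hfloor⟩ := axisFloor_of_hasEvenTorusLRO hLRO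
  refine ⟨a, ha, max M₀ 4, fun M _ hM hMle ψ hψK hψ1 hHψ => ?_⟩
  have h4 : 4 ≤ M := le_of_max_le_right hMle
  have hM₀ : M₀ ≤ M := le_of_max_le_left hMle
  set H : Op (TorusSite 2 M) 2 := xxzHamiltonian 1 (torusGraph 2 M) (-1) Δ with hHdef
  obtain ⟨φ, hφ0, -, hspan, hEsec⟩ := xxzTorus_groundSpace_eq_span M hM h4 hΔ
  -- `ψ` spans the ground space
  have hψG : ψ ∈ H.groundSpace := by
    rw [mem_groundSpace_iff, ← hEsec]; exact hHψ
  have hψ0 : ψ ≠ 0 := fun h => by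
    rw [h, dotProduct_zero] at hψ1
    exact zero_ne_one hψ1
  have hU : H.HasUniqueGroundState := by
    change Module.finrank ℂ H.groundSpace = 1
    rw [hspan]
    exact finrank_span_singleton hφ0
  have hω : ∀ O : Op (TorusSite 2 M) 2, H.groundStateFunctional O = star ψ ⬝ᵥ O *ᵥ ψ := fun O => by
    rw [groundStateFunctional_eq_of_hasUniqueGroundState hU hψG hψ0, hψ1, div_one]
  -- the floor, read as `a·M⁴ ≤ Re ω((Sˣ_tot)²)`
  have hfl := hfloor M hM hM₀
  simp only [← re_groundStateFunctional_xx_eq_axisCorr] at hfl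
  rw [sum_sum_re_groundStateFunctional_siteSpin] at hfl
  -- add the nonnegative `Re ω((Sʸ_tot)²)` and pass to the vector state
  have hY : 0 ≤ (H.groundStateFunctional (totalSpin 1 1 * totalSpin 1 1)).re :=
    re_groundStateFunctional_mul_self_nonneg _ (totalSpin_isHermitian 1 1)
  have hXY : a * (M : ℝ) ^ 4 ≤
      (H.groundStateFunctional (totalSpin 1 0 * totalSpin 1 0 + totalSpin 1 1 * totalSpin 1 1)).re := by
    rw [map_add, add_re]
    linarith
  rw [hω, ← raiseOn_mul_lowerOn_mulVec_of_mem_zero 1 hψK] at hXY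
  exact hXY

/-! ### Half-filled sector order ⇒ tracial planar LRO, at every `Δ ≤ 0` -/

/-- **Half-filled sector order ⇒ tracial planar LRO** at every `Δ ≤ 0`: if for all large even `M`
every normalised `S³_tot = 0` sector ground state `ψ` of `H_M(Δ)` has `c·M⁴ ≤ Re⟨ψ, S⁺_tot S⁻_tot ψ⟩`,
then the third-axis ground-state two-point function of `anisotropicTorus 2 M 1 1 Δ 1` has long-range
order along even tori, with `liminf ≥ c/2`. A normalised half-filled sector ground state exists and
spans the ground space (`xxzTorus_groundSpace_eq_span`, `Δ ≤ 0`), so the tracial functional is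
`⟨ψ, · ψ⟩`; `Re⟨ψ, S⁺S⁻ψ⟩ = ⟨ψ,(Sˣ_tot)²ψ⟩ + ⟨ψ,(Sʸ_tot)²ψ⟩ = 2⟨ψ,(Sˣ_tot)²ψ⟩`
(`dotProduct_totalSpinX_sq_eq_totalSpinY_sq`) `= 2 Σ_{x,y} G³_M(x,y)`; the LRO sequence is bounded
(`xyz_lroSeq_le`). [folklore] -/
theorem hasEvenTorusLRO_of_halfFilledOrderAt {Δ : ℝ} (hΔ : Δ ≤ 0)
    (hord : ∃ c : ℝ, 0 < c ∧ ∃ M₀ : ℕ, ∀ (M : ℕ) [NeZero M], Even M →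
      M₀ ≤ M → ∀ (ψ : TensorIndex (TorusSite 2 M) 2 → ℂ),
      ψ ∈ spinZSector (Λ := TorusSite 2 M) 1 0 → star ψ ⬝ᵥ ψ = 1 →
      Matrix.mulVec (xxzHamiltonian 1 (torusGraph 2 M) (-1) Δ) ψ =
        ((lowestEnergyInSector 1 (xxzHamiltonian 1 (torusGraph 2 M) (-1) Δ) 0 : ℝ) : ℂ) • ψ →
      c * (M : ℝ) ^ 4 ≤ (star ψ ⬝ᵥ Matrix.mulVec
        ((∑ x : TorusSite 2 M, onSite x (spinRaise 1)) *
          (∑ y : TorusSite 2 M, onSite y (spinLower 1))) ψ).re) :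
    HasEvenTorusLRO (fun L x y => groundStateAxisCorrTorus (d := 2) L 1 1 Δ 1 x y) := by
  obtain ⟨c, hc, M₀, hord⟩ := hord
  rw [hasEvenTorusLRO_iff]
  have hev : ∀ᶠ k : ℕ in atTop, c / 2 ≤
      (∑ x ∈ halfOpenBox 2 (2 * k), ∑ y ∈ halfOpenBox 2 (2 * k),
          torusPullback (fun L x y => groundStateAxisCorrTorus (d := 2) L 1 1 Δ 1 x y) (2 * k) x y) /
        ((halfOpenBox 2 (2 * k)).card : ℝ) ^ 2 := by
    filter_upwards [eventually_ge_atTop (max M₀ 2)] with k hk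
    have hkM₀ : M₀ ≤ 2 * k := (le_of_max_le_left hk).trans (by omega)
    have hk2 : 2 ≤ k := le_of_max_le_right hk
    haveI : NeZero (2 * k) := ⟨by omega⟩
    rw [XYOrderProofs.sum_halfOpenBox_torusPullback, card_halfOpenBox, Nat.cast_pow]
    set M : ℕ := 2 * k with hMdef
    have hM : Even M := even_two_mul k
    have h4 : 4 ≤ M := by omega
    set H : Op (TorusSite 2 M) 2 := xxzHamiltonian 1 (torusGraph 2 M) (-1) Δ with hHdef
    obtain ⟨φ, hφ0, hφK, hspan, hEsec⟩ := xxzTorus_groundSpace_eq_span M hM h4 hΔ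
    -- a normalised half-filled sector ground state spanning the ground space
    obtain ⟨r, -, hψ1⟩ := exists_smul_unit hφ0
    set ψ : TensorIndex (TorusSite 2 M) 2 → ℂ := r • φ with hψdef
    have hψK : ψ ∈ spinZSector (Λ := TorusSite 2 M) 1 0 := Submodule.smul_mem _ _ hφK
    have hφG : φ ∈ H.groundSpace := by
      rw [hspan]; exact Submodule.mem_span_singleton_self φ
    have hψG : ψ ∈ H.groundSpace := Submodule.smul_mem _ _ hφG
    have hψ0 : ψ ≠ 0 := fun h => by
      rw [h, dotProduct_zero] at hψ1
      exact zero_ne_one hψ1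
    have hHψ : H *ᵥ ψ = ((lowestEnergyInSector 1 H 0 : ℝ) : ℂ) • ψ := by
      rw [hEsec]; exact (mem_groundSpace_iff H ψ).1 hψG
    have hU : H.HasUniqueGroundState := by
      change Module.finrank ℂ H.groundSpace = 1
      rw [hspan]
      exact finrank_span_singleton hφ0
    have hω : ∀ O : Op (TorusSite 2 M) 2, H.groundStateFunctional O = star ψ ⬝ᵥ O *ᵥ ψ :=
      fun O => by rw [groundStateFunctional_eq_of_hasUniqueGroundState hU hψG hψ0, hψ1, div_one]
    -- the order hypothesis at this `ψ`, read as `c·M⁴ ≤ 2⟨ψ,(Sˣ_tot)²ψ⟩`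
    have h := hord M hM hkM₀ ψ hψK hψ1 hHψ
    have h' : c * (M : ℝ) ^ 4 ≤
        (star ψ ⬝ᵥ (raiseOn 1 Finset.univ * lowerOn 1 Finset.univ) *ᵥ ψ).re := h
    rw [raiseOn_mul_lowerOn_mulVec_of_mem_zero 1 hψK, add_mulVec, dotProduct_add, add_re,
      ← dotProduct_totalSpinX_sq_eq_totalSpinY_sq 1 hψK] at h'
    -- `Σ_{x,y} G³_M(x,y) = ⟨ψ,(Sˣ_tot)²ψ⟩`
    have hsum : ∑ x : TorusSite 2 M, ∑ y : TorusSite 2 M,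
        groundStateAxisCorrTorus (d := 2) M 1 1 Δ 1 x y =
          (star ψ ⬝ᵥ (totalSpin 1 0 * totalSpin 1 0) *ᵥ ψ).re := by
      simp only [← re_groundStateFunctional_xx_eq_axisCorr]
      rw [sum_sum_re_groundStateFunctional_siteSpin, hω]
    rw [hsum, le_div_iff₀ (by positivity)]
    have hpow : (((M : ℕ) : ℝ) ^ 2) ^ 2 = ((M : ℕ) : ℝ) ^ 4 := by ring
    rw [hpow]
    linarith
  exact lt_of_lt_of_le (half_pos hc)
    (le_liminf_of_le (isCoboundedUnder_ge_of_le atTop fun k => xyz_lroSeq_le (d := 2) 1 k 1 Δ) hev)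

/-- **Pointwise equivalence** at `Δ ≤ 0`: half-filled sector order of `H_M(Δ)` (the body of the hub at
`Δ`) iff tracial planar LRO of `anisotropicTorus 2 M 1 1 Δ 1`. [folklore] -/
theorem halfFilledOrderAt_iff_hasEvenTorusLRO {Δ : ℝ} (hΔ : Δ ≤ 0) :
    (∃ c : ℝ, 0 < c ∧ ∃ M₀ : ℕ, ∀ (M : ℕ) [NeZero M], Even M →
      M₀ ≤ M → ∀ (ψ : TensorIndex (TorusSite 2 M) 2 → ℂ),
      ψ ∈ spinZSector (Λ := TorusSite 2 M) 1 0 → star ψ ⬝ᵥ ψ = 1 →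
      Matrix.mulVec (xxzHamiltonian 1 (torusGraph 2 M) (-1) Δ) ψ =
        ((lowestEnergyInSector 1 (xxzHamiltonian 1 (torusGraph 2 M) (-1) Δ) 0 : ℝ) : ℂ) • ψ →
      c * (M : ℝ) ^ 4 ≤ (star ψ ⬝ᵥ Matrix.mulVec
        ((∑ x : TorusSite 2 M, onSite x (spinRaise 1)) *
          (∑ y : TorusSite 2 M, onSite y (spinLower 1))) ψ).re) ↔
    HasEvenTorusLRO (fun L x y => groundStateAxisCorrTorus (d := 2) L 1 1 Δ 1 x y) :=
  ⟨hasEvenTorusLRO_of_halfFilledOrderAt hΔ, halfFilledOrderAt_of_hasEvenTorusLRO hΔ⟩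

/-! ### Normal forms of the hub -/

/-- **Normal form of the hub `HalfFilledOrder`**: it is EXACTLY the statement that for every
`Δ ∈ (-1, 0]` the tracial ground states of Björnberg–Ueltschi's spin-½ anisotropic torus
`anisotropicTorus 2 L 1 1 Δ 1` (planar couplings `1`, Ising coupling `Δ`) have long-range order in a
planar direction along even tori — a Literature-vocabulary LRO statement
(`HasEvenTorusLRO`, `groundStateAxisCorrTorus`). [folklore] -/
theorem halfFilledOrder_iff_hasEvenTorusLRO :
    HalfFilledOrder ↔ ∀ Δ ∈ Set.Ioc (-1 : ℝ) 0,
      HasEvenTorusLRO (fun L x y => groundStateAxisCorrTorus (d := 2) L 1 1 Δ 1 x y) := by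
  constructor
  · intro h Δ hΔ
    exact hasEvenTorusLRO_of_halfFilledOrderAt hΔ.2 (h Δ hΔ)
  · intro h Δ hΔ
    exact halfFilledOrderAt_of_hasEvenTorusLRO hΔ.2 (h Δ hΔ)

/-- **What is open, in Literature vocabulary**: since the window `[-0.109, 0]` is proved
(`halfFilledOrder_window`, Björnberg–Ueltschi), the hub `HalfFilledOrder` is EQUIVALENT to tracial
planar LRO of `anisotropicTorus 2 L 1 1 Δ 1` for every `Δ` in the deep easy-plane interval
`(-1, -0.109)` — the spin-½, `d = 2` near-Heisenberg regime, open in print.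
[cite: BjornbergUeltschi2022, Theorem 3.2 and p. 11] -/
theorem halfFilledOrder_iff_hasEvenTorusLRO_deep :
    HalfFilledOrder ↔ ∀ Δ ∈ Set.Ioo (-1 : ℝ) (-0.109),
      HasEvenTorusLRO (fun L x y => groundStateAxisCorrTorus (d := 2) L 1 1 Δ 1 x y) := by
  constructor
  · intro h Δ hΔ
    exact hasEvenTorusLRO_of_halfFilledOrderAt (by linarith [hΔ.2]) (h Δ ⟨hΔ.1, by linarith [hΔ.2]⟩)
  · intro h
    exact halfFilledOrder_of_deepWindow fun Δ hΔ =>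
      halfFilledOrderAt_of_hasEvenTorusLRO (by linarith [hΔ.2]) (h Δ hΔ)

/-! ### The Wischmann–Müller-Hartmann window (conditional on the vendored, undischarged fact) -/

/-- **Half-filled sector order on the Wischmann–Müller-Hartmann window `Δ ∈ [-0.22, 0]`,
CONDITIONAL on `wischmannMullerHartmann1991_ground_lro_spinHalf`** (vendored statement of
J. Phys. I France 1 (1991) 647, Abstract and §5: staggered planar LRO of the spin-½ XXZ
antiferromagnet for `0 ≤ Δ_AF ≤ 0.22`, i.e. tracial planar LRO of `anisotropicTorus 2 L 1 1 (-Δ_AF) 1`;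
NOT discharged in the tree — its printed inputs are floating-point Lanczos energies). Instantiate the
fact at `Δ_AF = -Δ` and apply `halfFilledOrderAt_of_hasEvenTorusLRO`.
[cite: WischmannMullerhartmann1991, Abstract (p. 647) and §5 (pp. 654–655, Table I)] -/
theorem halfFilledOrder_wmhWindow (hWMH : wischmannMullerHartmann1991_ground_lro_spinHalf) :
    ∀ Δ ∈ Set.Icc (-0.22 : ℝ) 0, ∃ c : ℝ, 0 < c ∧ ∃ M₀ : ℕ, ∀ (M : ℕ) [NeZero M], Even M →
      M₀ ≤ M → ∀ (ψ : TensorIndex (TorusSite 2 M) 2 → ℂ),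
      ψ ∈ spinZSector (Λ := TorusSite 2 M) 1 0 → star ψ ⬝ᵥ ψ = 1 →
      Matrix.mulVec (xxzHamiltonian 1 (torusGraph 2 M) (-1) Δ) ψ =
        ((lowestEnergyInSector 1 (xxzHamiltonian 1 (torusGraph 2 M) (-1) Δ) 0 : ℝ) : ℂ) • ψ →
      c * (M : ℝ) ^ 4 ≤ (star ψ ⬝ᵥ Matrix.mulVec
        ((∑ x : TorusSite 2 M, onSite x (spinRaise 1)) *
          (∑ y : TorusSite 2 M, onSite y (spinLower 1))) ψ).re := by
  intro Δ hΔ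
  have hL := hWMH (-Δ) (by linarith [hΔ.2]) (by linarith [hΔ.1])
  simp only [neg_neg] at hL
  exact halfFilledOrderAt_of_hasEvenTorusLRO hΔ.2 hL

/-- **Conditional deep normal form**: given the Wischmann–Müller-Hartmann window, the hub
`HalfFilledOrder` is equivalent to tracial planar LRO of `anisotropicTorus 2 L 1 1 Δ 1` for every
`Δ ∈ (-1, -0.22)`. [cite: WischmannMullerhartmann1991, Abstract (p. 647) and §5 (pp. 654–655, Table I)] -/
theorem halfFilledOrder_iff_hasEvenTorusLRO_deep_of_wmh
    (hWMH : wischmannMullerHartmann1991_ground_lro_spinHalf) :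
    HalfFilledOrder ↔ ∀ Δ ∈ Set.Ioo (-1 : ℝ) (-0.22),
      HasEvenTorusLRO (fun L x y => groundStateAxisCorrTorus (d := 2) L 1 1 Δ 1 x y) := by
  constructor
  · intro h Δ hΔ
    exact hasEvenTorusLRO_of_halfFilledOrderAt (by linarith [hΔ.2]) (h Δ ⟨hΔ.1, by linarith [hΔ.2]⟩)
  · intro h Δ hΔ
    by_cases hw : -0.22 ≤ Δ
    · exact halfFilledOrder_wmhWindow hWMH Δ ⟨hw, hΔ.2⟩
    · exact halfFilledOrderAt_of_hasEvenTorusLRO hΔ.2 (h Δ ⟨hΔ.1, lt_of_not_ge hw⟩)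

end Summit.HubbardSuperconductivity.HubbardSuperconductivity.Theorems.LevyLogBootstrap
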